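import Mathlib
import Literature.NumberTheory.LFunctions.Zhang2022.Section7dStatements
import HarnessLib

/-!
# Zhang (2022) §7 p. 40: `|κ(n)| ≤ τ₄(n) ≤ τ₅(n)` and the numerical range of the "simple bounds" (for node `Z22:§7.u046`)

Topic `Literature/NumberTheory/LFunctions/Zhang2022` (Landau–Siegel audit tree; verdict-neutral).
Y. Zhang, *Discrete mean estimates and the Landau–Siegel zero*, arXiv:2211.02515v1 (2022)
[Zhang2022LandauSiegel] — **an unrefereed manuscript under adjudication.** Cell siegel-zhang
(D-0069), first half of the discharge of the proof-internal step `Z22:§7.u046` of Proposition 7.1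
(c) (§7 p. 40, tex L2105: "By the simple bounds `|κ̃(d₁;d₂k,s)| ≤ τ₅(d₁)∏_{q∣d₁}|1 + c/q^σ|`,
`|λ(m,s)| ≤ ∏_{q∣m}|1 + c/q^σ|` for `σ > 9/10` …"); the companion `Section7KappaBounds.lean`
proves the node (`Section7dStatements.step7u046_holds`, with `c = 200`). Theorems only:

* §1 `|κ(q^k)| ≤ C(k+3,3) = τ₄(q^k)` for the tree's `κ = n^{−ib₁} ∗ n^{−ib₂} ∗ n^{−ib₃} ∗ μ`
  (`MeanSquareMajorant.kappa`; `Σκ(n)n^{−s} = ζ(s+β₁)ζ(s+β₂)ζ(s+β₃)/ζ(s)`, §7 p. 34): three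
  hockey-stick sums (`norm_kappa_prime_pow_le_choose`);
* §2 `τ₄ = ζ^4`, `τ₅ = ζ^5 = tauFive`: `(ζ^{k+1})(q^e) = C(e+k,k)`, `|κ(n)| ≤ τ₄(n)`
  (`norm_kappa_le_tau4`), `τ₄(mn) ≤ τ₄(m)τ₄(n)` for all `m, n ≥ 1` (`tau4_mul_le`, from
  `C(a+e+3,3) ≤ C(a+3,3)C(e+3,3)`), `τ₄ ≤ τ₅` (`tau4_le_tauFive`);
* §3 the range `0 < q^{−σ} ≤ 2^{−9/10} ≤ 3/5` for `σ > 9/10` (`rpow_neg_range`) and the two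
  polynomial inequalities `(1+x)³ ≤ (1+200x)(1−x)`, `1 ≤ (1+200x)(1−x)⁴` on `[0, 3/5]`
  (`cube_le`, `one_le_quartic`) that make `c = 200` admissible.

WHAT THIS IS NOT: any statement about Theorems 1–2 of the manuscript or about Landau–Siegel zeros.

## References

* Y. Zhang, arXiv:2211.02515v1 (2022), §7 p. 32 (`κ̃`, `λ`), p. 34 (`κ`), p. 40, tex L2105.
  [cite: Zhang2022LandauSiegel, §7 p.40]
-/

noncomputable section

open Complex ArithmeticFunction Finset

namespace Literature.NumberTheory.LFunctions.Zhang2022.KappaBounds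

open MeanSquareMajorant (kappa powI isMultiplicative_kappa isMultiplicative_powI norm_powI_of_pos)

/-! ### §1. `|κ(q^k)| ≤ τ₄(q^k) = C(k+3,3)` -/

variable {q : ℕ}

/-- If `‖f(q^i)‖ ≤ P(i)` and `‖g(q^j)‖ ≤ 1` at all powers of the prime `q`, then
`‖(f ∗ g)(q^k)‖ ≤ Σ_{i ≤ k} P(i)`. [folklore] -/
private theorem norm_mul_prime_pow_le_sum {f g : ArithmeticFunction ℂ} (hq : q.Prime) {P : ℕ → ℝ}
    (hf : ∀ i, ‖f (q ^ i)‖ ≤ P i) (hg : ∀ j, ‖g (q ^ j)‖ ≤ 1) (k : ℕ) :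
    ‖(f * g) (q ^ k)‖ ≤ ∑ i ∈ Finset.range (k + 1), P i := by
  rw [RankinEisenstein.mul_apply_prime_pow f g hq k]
  refine (norm_sum_le _ _).trans (Finset.sum_le_sum fun i _ => ?_)
  rw [norm_mul]
  calc ‖f (q ^ i)‖ * ‖g (q ^ (k - i))‖ ≤ P i * 1 :=
        mul_le_mul (hf i) (hg _) (norm_nonneg _) ((norm_nonneg _).trans (hf i))
    _ = P i := mul_one _

/-- The hockey-stick identity, cast to `ℝ`: `Σ_{i ≤ n} C(i+k,k) = C(n+k+1,k+1)`. [folklore] -/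
private theorem sum_range_choose_cast (n k : ℕ) :
    ∑ i ∈ Finset.range (n + 1), (((i + k).choose k : ℕ) : ℝ) = (((n + k + 1).choose (k + 1) : ℕ) : ℝ) := by
  rw [← Nat.cast_sum, Nat.sum_range_add_choose]

/-- **`|κ(q^k)| ≤ C(k+3,3)`** (`= τ₄(q^k)`): `κ = n^{−ib₁} ∗ n^{−ib₂} ∗ n^{−ib₃} ∗ μ` with unimodular
shifts and `|μ| ≤ 1`, by three applications of the hockey-stick identity.
[cite: Zhang2022LandauSiegel, §7 p.40, tex L2105] -/
theorem norm_kappa_prime_pow_le_choose (b₁ b₂ b₃ : ℝ) (hq : q.Prime) (k : ℕ) :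
    ‖kappa b₁ b₂ b₃ (q ^ k)‖ ≤ (((k + 3).choose 3 : ℕ) : ℝ) := by
  have hI : ∀ (b : ℝ) (i : ℕ), ‖powI b (q ^ i)‖ ≤ 1 := fun b i =>
    (norm_powI_of_pos b (pow_pos hq.pos i)).le
  have hμ : ∀ j : ℕ, ‖(ArithmeticFunction.moebius : ArithmeticFunction ℂ) (q ^ j)‖ ≤ 1 := fun j =>
    norm_moebius_complex_le_one _
  have h0 : ∀ i : ℕ, ‖powI b₁ (q ^ i)‖ ≤ (((i + 0).choose 0 : ℕ) : ℝ) := fun i => by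
    rw [Nat.choose_zero_right, Nat.cast_one]; exact hI b₁ i
  have h1 : ∀ i : ℕ, ‖(powI b₁ * powI b₂) (q ^ i)‖ ≤ (((i + 1).choose 1 : ℕ) : ℝ) := fun i => by
    have := norm_mul_prime_pow_le_sum hq h0 (hI b₂) i
    rwa [sum_range_choose_cast] at this
  have h2 : ∀ i : ℕ, ‖(powI b₁ * powI b₂ * powI b₃) (q ^ i)‖ ≤ (((i + 2).choose 2 : ℕ) : ℝ) :=
    fun i => by
    have := norm_mul_prime_pow_le_sum hq h1 (hI b₃) i
    rwa [sum_range_choose_cast] at this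
  have h3 := norm_mul_prime_pow_le_sum hq h2 hμ k
  rw [sum_range_choose_cast] at h3
  exact h3

/-! ### §2. `τ₄ = ζ ∗ ζ ∗ ζ ∗ ζ` and `τ₅`; `|κ(n)| ≤ τ₄(n) ≤ τ₅(n)` -/

/-- `(ζ^{k+1})(q^e) = C(e+k,k)` at a prime `q` (the divisor functions `τ_{k+1}` at prime powers;
`τ₅ = ζ^5` is the typing's `tauFive`). [cite: Zhang2022LandauSiegel, §7 p.40, tex L2105] -/
theorem zeta_pow_succ_prime_pow (hq : q.Prime) (k e : ℕ) :
    (ArithmeticFunction.zeta ^ (k + 1) : ArithmeticFunction ℕ) (q ^ e) = (e + k).choose k := by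
  induction k generalizing e with
  | zero => rw [zero_add, pow_one, ArithmeticFunction.zeta_apply_ne (pow_ne_zero e hq.ne_zero),
      add_zero, Nat.choose_zero_right]
  | succ k ih =>
    rw [pow_succ, RankinEisenstein.mul_apply_prime_pow _ _ hq e]
    have h : ∀ i ∈ Finset.range (e + 1),
        (ArithmeticFunction.zeta ^ (k + 1) : ArithmeticFunction ℕ) (q ^ i) *
          ArithmeticFunction.zeta (q ^ (e - i)) = (i + k).choose k := fun i _ => by
      rw [ih, ArithmeticFunction.zeta_apply_ne (pow_ne_zero _ hq.ne_zero), mul_one]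
    rw [Finset.sum_congr rfl h, Nat.sum_range_add_choose, add_assoc]

/-- `τ₄ = ζ^4` is multiplicative. [folklore] -/
private theorem isMultiplicative_zeta4 :
    (ArithmeticFunction.zeta ^ 4 : ArithmeticFunction ℕ).IsMultiplicative :=
  ArithmeticFunction.isMultiplicative_zeta.pow

/-- **`|κ(n)| ≤ τ₄(n)`** for `n ≥ 1` (multiplicativity and the prime-power bound).
[cite: Zhang2022LandauSiegel, §7 p.40, tex L2105] -/
theorem norm_kappa_le_tau4 (b₁ b₂ b₃ : ℝ) {n : ℕ} (hn : n ≠ 0) :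
    ‖kappa b₁ b₂ b₃ n‖ ≤ (((ArithmeticFunction.zeta ^ 4 : ArithmeticFunction ℕ) n : ℕ) : ℝ) := by
  rw [(isMultiplicative_kappa b₁ b₂ b₃).multiplicative_factorization _ hn,
    isMultiplicative_zeta4.multiplicative_factorization _ hn, Finsupp.prod, Finsupp.prod,
    Nat.cast_prod]
  refine (Finset.norm_prod_le _ _).trans (Finset.prod_le_prod (fun _ _ => norm_nonneg _) fun p hp => ?_)
  have hp' : p.Prime := Nat.prime_of_mem_primeFactors (Nat.support_factorization n ▸ hp)
  rw [show (4 : ℕ) = 3 + 1 from rfl, zeta_pow_succ_prime_pow hp' 3]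
  exact norm_kappa_prime_pow_le_choose b₁ b₂ b₃ hp' _

/-- `6·C(a+3,3) = (a+1)(a+2)(a+3)`. [folklore] -/
private theorem six_mul_choose_three (a : ℕ) : 6 * (a + 3).choose 3 = (a + 1) * (a + 2) * (a + 3) := by
  have h := Nat.ascFactorial_eq_factorial_mul_choose a 3
  rw [Nat.ascFactorial_succ, Nat.ascFactorial_succ, Nat.ascFactorial_succ, Nat.ascFactorial_zero,
    show (3 : ℕ).factorial = 6 from rfl] at h
  -- h : (a + 1 + 2) * ((a + 1 + 1) * ((a + 1 + 0) * 1)) = 6 * (a + 3).choose 3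
  rw [← h]; ring

/-- **`τ₄` is sub-multiplicative at prime powers**: `C(a+e+3,3) ≤ C(a+3,3)·C(e+3,3)`
(`k(a+e+k) ≤ (a+k)(e+k)` for `k = 1,2,3`). [folklore] -/
private theorem choose_three_add_le (a e : ℕ) :
    (a + e + 3).choose 3 ≤ (a + 3).choose 3 * (e + 3).choose 3 := by
  have h36 : 36 * (a + e + 3).choose 3 ≤ 36 * ((a + 3).choose 3 * (e + 3).choose 3) := by
    have e1 : 36 * (a + e + 3).choose 3 = 6 * ((a + e + 1) * (a + e + 2) * (a + e + 3)) := by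
      rw [← six_mul_choose_three (a + e)]; ring
    have e2 : 36 * ((a + 3).choose 3 * (e + 3).choose 3) =
        ((a + 1) * (a + 2) * (a + 3)) * ((e + 1) * (e + 2) * (e + 3)) := by
      rw [← six_mul_choose_three a, ← six_mul_choose_three e]; ring
    rw [e1, e2]
    have k1 : 1 * (a + e + 1) ≤ (a + 1) * (e + 1) := by nlinarith
    have k2 : 2 * (a + e + 2) ≤ (a + 2) * (e + 2) := by nlinarith
    have k3 : 3 * (a + e + 3) ≤ (a + 3) * (e + 3) := by nlinarith
    calc 6 * ((a + e + 1) * (a + e + 2) * (a + e + 3))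
        = (1 * (a + e + 1)) * (2 * (a + e + 2)) * (3 * (a + e + 3)) := by ring
      _ ≤ ((a + 1) * (e + 1)) * ((a + 2) * (e + 2)) * ((a + 3) * (e + 3)) :=
          Nat.mul_le_mul (Nat.mul_le_mul k1 k2) k3
      _ = ((a + 1) * (a + 2) * (a + 3)) * ((e + 1) * (e + 2) * (e + 3)) := by ring
  exact Nat.le_of_mul_le_mul_left h36 (by norm_num)

/-- **`τ₄(mn) ≤ τ₄(m)τ₄(n)`** for all `m, n ≥ 1` (prime by prime) — the sub-multiplicativity
behind `|κ(d₁h)| ≤ τ₄(d₁)τ₄(h)` in the "simple bound" for `κ̃(d₁;m,s)`.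
[cite: Zhang2022LandauSiegel, §7 p.40, tex L2105] -/
theorem tau4_mul_le {m n : ℕ} (hm : m ≠ 0) (hn : n ≠ 0) :
    (ArithmeticFunction.zeta ^ 4 : ArithmeticFunction ℕ) (m * n) ≤
      (ArithmeticFunction.zeta ^ 4 : ArithmeticFunction ℕ) m *
        (ArithmeticFunction.zeta ^ 4 : ArithmeticFunction ℕ) n := by
  set T := (ArithmeticFunction.zeta ^ 4 : ArithmeticFunction ℕ) with hT
  have hT4 : ∀ {p : ℕ}, p.Prime → ∀ e : ℕ, T (p ^ e) = (e + 3).choose 3 := fun hp e => by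
    rw [hT, show (4 : ℕ) = 3 + 1 from rfl, zeta_pow_succ_prime_pow hp 3]
  rw [isMultiplicative_zeta4.multiplicative_factorization _ (mul_ne_zero hm hn),
    isMultiplicative_zeta4.multiplicative_factorization _ hm,
    isMultiplicative_zeta4.multiplicative_factorization _ hn, Nat.factorization_mul hm hn]
  -- write all three products over the support of `m.factorization + n.factorization`
  set S := (m.factorization + n.factorization).support with hS
  have hsub_m : m.factorization.support ⊆ S := by
    intro p hp
    rw [hS, Finsupp.mem_support_iff, Finsupp.add_apply]
    have := Finsupp.mem_support_iff.mp hp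
    omega
  have hsub_n : n.factorization.support ⊆ S := by
    intro p hp
    rw [hS, Finsupp.mem_support_iff, Finsupp.add_apply]
    have := Finsupp.mem_support_iff.mp hp
    omega
  have hprime : ∀ p ∈ S, p.Prime := fun p hp => by
    rw [hS, Finsupp.mem_support_iff, Finsupp.add_apply] at hp
    by_cases h1 : m.factorization p = 0
    · have h2 : n.factorization p ≠ 0 := by omega
      exact Nat.prime_of_mem_primeFactors (Nat.support_factorization n ▸ Finsupp.mem_support_iff.mpr h2)
    · exact Nat.prime_of_mem_primeFactors (Nat.support_factorization m ▸ Finsupp.mem_support_iff.mpr h1)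
  rw [Finsupp.prod,
    Finsupp.prod_of_support_subset _ hsub_m _ (fun p _ => by
      rw [pow_zero]; exact isMultiplicative_zeta4.map_one),
    Finsupp.prod_of_support_subset _ hsub_n _ (fun p _ => by
      rw [pow_zero]; exact isMultiplicative_zeta4.map_one),
    ← Finset.prod_mul_distrib]
  refine Finset.prod_le_prod (fun _ _ => Nat.zero_le _) fun p hp => ?_
  rw [Finsupp.add_apply, hT4 (hprime p hp), hT4 (hprime p hp), hT4 (hprime p hp)]
  exact choose_three_add_le _ _

/-- **`τ₄(n) ≤ τ₅(n)`** for `n ≥ 1` (`τ₅ = τ₄ ∗ ζ ≥` its term `d = n`; `τ₅` = the typing's `tauFive`).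
[cite: Zhang2022LandauSiegel, §7 p.40, tex L2105] -/
theorem tau4_le_tauFive {n : ℕ} (hn : n ≠ 0) :
    (ArithmeticFunction.zeta ^ 4 : ArithmeticFunction ℕ) n ≤ Section7dStatements.tauFive n := by
  have h5 : (ArithmeticFunction.zeta ^ 5 : ArithmeticFunction ℕ) = ArithmeticFunction.zeta ^ 4 * ArithmeticFunction.zeta :=
    pow_succ _ 4
  rw [Section7dStatements.tauFive, h5, ArithmeticFunction.mul_apply]
  have hmem : (n, 1) ∈ n.divisorsAntidiagonal := Nat.mem_divisorsAntidiagonal.mpr ⟨mul_one n, hn⟩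
  calc (ArithmeticFunction.zeta ^ 4 : ArithmeticFunction ℕ) n
      = (ArithmeticFunction.zeta ^ 4 : ArithmeticFunction ℕ) (n, 1).1 * ArithmeticFunction.zeta (n, 1).2 := by
        rw [ArithmeticFunction.zeta_apply_ne one_ne_zero, mul_one]
    _ ≤ ∑ x ∈ n.divisorsAntidiagonal,
          (ArithmeticFunction.zeta ^ 4 : ArithmeticFunction ℕ) x.1 * ArithmeticFunction.zeta x.2 :=
        Finset.single_le_sum (f := fun x : ℕ × ℕ =>
          (ArithmeticFunction.zeta ^ 4 : ArithmeticFunction ℕ) x.1 * ArithmeticFunction.zeta x.2)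
          (fun x _ => Nat.zero_le _) hmem

/-! ### §3. The numerical range `q^{−σ} ≤ 2^{−9/10} < 3/5` and two polynomial inequalities -/

/-- `2^{−9/10} ≤ 3/5` (`(5/3)^{10} = 9765625/59049 < 512 = 2^9`). [folklore] -/
private theorem two_rpow_neg_nine_tenths_le : (2 : ℝ) ^ (-(9 / 10 : ℝ)) ≤ 3 / 5 := by
  have h1 : ((5 : ℝ) / 3) ^ (10 : ℝ) ≤ (2 : ℝ) ^ (9 : ℝ) := by
    rw [show (10 : ℝ) = (10 : ℕ) by norm_num, show (9 : ℝ) = (9 : ℕ) by norm_num,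
      Real.rpow_natCast, Real.rpow_natCast]
    norm_num
  have h2 : (5 : ℝ) / 3 ≤ (2 : ℝ) ^ ((9 : ℝ) / 10) := by
    have e1 : (5 : ℝ) / 3 = (((5 : ℝ) / 3) ^ (10 : ℝ)) ^ ((1 : ℝ) / 10) := by
      rw [← Real.rpow_mul (by norm_num)]; norm_num
    have e2 : (2 : ℝ) ^ ((9 : ℝ) / 10) = ((2 : ℝ) ^ (9 : ℝ)) ^ ((1 : ℝ) / 10) := by
      rw [← Real.rpow_mul (by norm_num)]; norm_num
    rw [e1, e2]
    exact Real.rpow_le_rpow (by positivity) h1 (by norm_num)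
  rw [Real.rpow_neg (by norm_num)]
  have h3 : (0 : ℝ) < (2 : ℝ) ^ ((9 : ℝ) / 10) := by positivity
  rw [inv_le_comm₀ h3 (by norm_num)]
  calc ((3 : ℝ) / 5)⁻¹ = 5 / 3 := by norm_num
    _ ≤ _ := h2

/-- For a prime `q` and `σ > 9/10` (the range of the "simple bounds"): `0 < q^{−σ} ≤ 3/5`.
[cite: Zhang2022LandauSiegel, §7 p.40, tex L2105] -/
theorem rpow_neg_range {q : ℕ} (hq : q.Prime) {σ : ℝ} (hσ : 9 / 10 < σ) :
    0 < (q : ℝ) ^ (-σ) ∧ (q : ℝ) ^ (-σ) ≤ 3 / 5 := by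
  have hq2 : (2 : ℝ) ≤ q := by exact_mod_cast hq.two_le
  refine ⟨Real.rpow_pos_of_pos (by linarith) _, ?_⟩
  calc (q : ℝ) ^ (-σ) ≤ (2 : ℝ) ^ (-σ) :=
        Real.rpow_le_rpow_of_nonpos (by norm_num) hq2 (by linarith)
    _ ≤ (2 : ℝ) ^ (-(9 / 10 : ℝ)) := Real.rpow_le_rpow_of_exponent_le (by norm_num) (by linarith)
    _ ≤ 3 / 5 := two_rpow_neg_nine_tenths_le

/-- `(1+x)³ ≤ (1 + 200x)(1 − x)` for `0 ≤ x ≤ 3/5` (the `λ`-factor of the "simple bounds" with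
`c = 200`). [cite: Zhang2022LandauSiegel, §7 p.40, tex L2105] -/
theorem cube_le {x : ℝ} (h0 : 0 ≤ x) (h1 : x ≤ 3 / 5) :
    (1 + x) ^ 3 ≤ (1 + 200 * x) * (1 - x) := by
  nlinarith [mul_nonneg h0 (sub_nonneg.mpr h1), mul_nonneg (mul_nonneg h0 h0) (sub_nonneg.mpr h1),
    mul_nonneg (mul_nonneg h0 h0) h0]

/-- `1 ≤ (1 + 200x)(1 − x)⁴` for `0 ≤ x ≤ 3/5` (the `κ̃`-factor of the "simple bounds" with
`c = 200`). [cite: Zhang2022LandauSiegel, §7 p.40, tex L2105] -/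
theorem one_le_quartic {x : ℝ} (h0 : 0 ≤ x) (h1 : x ≤ 3 / 5) :
    1 ≤ (1 + 200 * x) * (1 - x) ^ 4 := by
  by_cases hx : x ≤ 6 / 25
  · -- `(1 − x)⁴ ≥ 1 − 4x` and `(1 + 200x)(1 − 4x) ≥ 1` for `x ≤ 0.245`
    have hb : 1 - 4 * x ≤ (1 - x) ^ 4 := by nlinarith [sq_nonneg x, sq_nonneg (x * x), mul_nonneg h0 h0]
    have hc : 1 ≤ (1 + 200 * x) * (1 - 4 * x) := by nlinarith
    calc (1 : ℝ) ≤ (1 + 200 * x) * (1 - 4 * x) := hc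
      _ ≤ (1 + 200 * x) * (1 - x) ^ 4 := mul_le_mul_of_nonneg_left hb (by linarith)
  · push Not at hx
    have hb : ((2 : ℝ) / 5) ^ 4 ≤ (1 - x) ^ 4 :=
      pow_le_pow_left₀ (by norm_num) (by linarith) 4
    calc (1 : ℝ) ≤ 49 * ((2 : ℝ) / 5) ^ 4 := by norm_num
      _ ≤ (1 + 200 * x) * (1 - x) ^ 4 := mul_le_mul (by linarith) hb (by positivity) (by linarith)

end Literature.NumberTheory.LFunctions.Zhang2022.KappaBounds
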